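import Summits.QuantumFields.YangMills.Theorems.UnitScaleTiltProp7CentreHarmonicDivFlat
import Literature.MathematicalPhysics.QuantumFieldTheory.Balaban1983to89.B5Phi162Torus
import HarnessLib

/-!
# Route `UnitScaleTilt`, crux K1 «MinimiserStabilityRegPr» (stmt-QuantumFields-19200), route-R E′ path (α′) — the displayed row (E) of ✓ `…CentreHarmonicRegaugeSup(Cov)`, FLAT MODEL:
# THE PINNED BIHARMONIC INTERPOLANT EXISTS, BY FOURIER.  For every datum `m` on the centres there is `u` on `T_η` with `u ∘ up = m` and `Δ²u = 0` off the centres; in momentum its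
# alias weights are `Δ(p′+l)⁻²∕S₂(p′)`, `S₂ = Σ_lΔ(p′+l)⁻²` — the lattice twin of the cardinal biharmonic spline symbol `|ξ+2πj|⁻⁴∕Σ_j|ξ+2πj|⁻⁴` (Madych–Nelson 1990)

Cell `ym3-torus`, D-0154 (3c) twin-width seat `ym-routeR-w3` (gen 5); residue (hK)∕(E) of the (α′) sup row (★p1 g14 17:53:40Z, first refusal routeR-w3; LOCATE 19200 evidence #53 §6).
THEOREMS ONLY (0 `def`, 0 `sorry`); `--supports stmt-QuantumFields-19200`, count-neutral.  YM₃ on T³ is a ladder rung (R3), not the Clay problem; nothing here claims the stub, the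
crux, d = 4 or the gap.

THE CONSTRUCTION (B5 carrier `Tor (fine n M)`, η-units `Δ = LapS … n`, centres `up y`, letters of ✓ `…CentreHarmonicDivFlat`).  Given `m : Tor M → ℂ`, put `r = c_f∕c_M`, `S₂(p′) = Σ_l D_l(p′)⁻²`
(`D_l(p′) = DeltaXir n 0 (shiftr n l (sOf p′))`), choose charges `q` with `q̂(p′) = m̂(p′)∕(r²S₂(p′))` for `p′ ≠ 0`, `q̂(0) = 0` (so `Σq = 0`), the comb `g = Σ_y q_y δ_{up y}`, `u₀ = Δ⁻²g` and
`u = u₀ + c₀` with the constant `c₀` matching the means.  Then `Δ²u = Δ²Δ⁻²g = g − P_ker g = g` (✓ `LapS_mul_LapSinv`, `Pker_orth`; `Σg = Σq = 0`) vanishes off the centres, and by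
POISSON (✓ `dft_sample_up`) + the comb's flat alias weights (✓ `dft_comb_pOf`): `(u₀∘up)^(p′) = r·Σ_l ĝ(p′+l)∕D_l² = r²q̂(p′)S₂(p′) = m̂(p′)` for `p′ ≠ 0`; the fibre `p′ = 0` is the mean, fixed by `c₀`.

WHAT IS PROVED (ns `…Theorems.Prop7CentreHarmonicInterpolantFlat`).
* §1 (the DFT of a constant off `p′ = 0` is ✓ `B5Phi162Torus.dft_const_of_ne`) `dft_conjTranspose_mulVec` (`F(Fᴴv) = v`), `sum_eq_of_dft_zero` (`q̂(0) = 0 ⇒ Σq = 0`), `sum_comb`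
  (`Σ_x g = Σ_y q`), `aliasSum_pos` (`S₂(p′) > 0` for `p′ ≠ 0`), `eq_of_dft_eq` (injectivity of the DFT).
* §2 ★★★ `exists_pinned_biharmonic_interpolant (hn : 1 ≤ n) (m) : ∃ u, (∀ y, u (up y) = m y) ∧ ∀ x, (∀ y, x ≠ up y) → (Δ(Δu))(x) = 0`.
HONEST SCOPE.  Flat, scalar, B5 carrier (the `Site (F.P K) 0` reading is px17's ✓ `…CentreHarmonicDivDictionary` letters `EK`∕middle-offset translate — not repeated here); the
Euler–Lagrange property is what is proved (it characterises the `‖Δ·‖²`-minimal interpolant; minimality itself is not needed by ✓ `…RegaugeSup`).  The analytic row (hK) is NOT touched.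

References: T. Bałaban, CMP 95 (1984) 17–40 [Balaban1984PropagatorsI] ((1.29)–(1.31) p.23, Sect. C p.22); W. R. Madych, S. A. Nelson, J. Approx. Theory 60 (1990) 141–156
(polyharmonic cardinal splines; cited for orientation only, nothing of it is asserted); CMP 99 (1985) 75–102 [Balaban1985RegularSpaces] ((1.14) p.78).
-/

set_option autoImplicit false

noncomputable section

open scoped BigOperators Matrix ComplexConjugate ComplexOrder
open Finset Complex Matrix

namespace Summit.QuantumFields.YangMills.Theorems.Prop7CentreHarmonicInterpolantFlat

open Literature.MathematicalPhysics.QuantumFieldTheory.Balaban1983to89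
open B4Strip B5Prop11Fiber B5Prop11Leaves B5Prop11Plancherel B5Action121 B5Block118 B5LaplaceInverse B5LaplaceSpectral
open B5Momentum130 B5Momentum133 B5Eq135Momentum
open Prop7CentreHarmonicDivFlat

variable {d : ℕ}

/-! ## §1 Tools -/

section AnyTorus

variable (N : Fin d → ℕ) [hN : ∀ μ, NeZero (N μ)]

/-- `F (Fᴴ v) = v` (the DFT is unitary). [folklore] -/
theorem dft_conjTranspose_mulVec (v : Tor N → ℂ) : dft N *ᵥ ((dft N)ᴴ *ᵥ v) = v := by
  rw [Matrix.mulVec_mulVec, ← Matrix.star_eq_conjTranspose, dft_mul_star, Matrix.one_mulVec]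

/-- `q̂(0) = c_T·Σq`, so `q̂(0) = 0 ⇒ Σq = 0`. [folklore] -/
theorem sum_eq_of_dft_zero (q : Tor N → ℂ) (h0 : (dft N *ᵥ q) 0 = 0) : ∑ y, q y = 0 := by
  have h : (dft N *ᵥ q) 0 = (cT N : ℂ) * ∑ y, q y := by
    simp only [Matrix.mulVec, dotProduct, dft_apply', chi_zero_left, map_one, mul_one, Finset.mul_sum]
  rw [h] at h0
  exact (mul_eq_zero.mp h0).resolve_left (cT_ne_zero N)

/-- injectivity of the DFT: equal transforms, equal functions. [folklore] -/
theorem eq_of_dft_eq (f g : Tor N → ℂ) (h : dft N *ᵥ f = dft N *ᵥ g) : f = g := by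
  have hU : (dft N)ᴴ * dft N = 1 := dft_conjTranspose_mul N
  calc f = ((dft N)ᴴ * dft N) *ᵥ f := by rw [hU, Matrix.one_mulVec]
    _ = (dft N)ᴴ *ᵥ (dft N *ᵥ g) := by rw [← Matrix.mulVec_mulVec, h]
    _ = g := by rw [Matrix.mulVec_mulVec, hU, Matrix.one_mulVec]

end AnyTorus

section TwoTori

variable (n : ℕ) [NeZero n] (M : Fin d → ℕ) [hM : ∀ μ, NeZero (M μ)]

/-- the total mass of a comb is the total charge. [folklore] -/
theorem sum_comb (q : Tor M → ℂ) : ∑ x : Tor (fine n M), (∑ y, if x = up n M y then q y else 0) = ∑ y, q y := by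
  rw [Finset.sum_comm]
  refine Finset.sum_congr rfl fun y _ => ?_
  simp only [Finset.sum_ite_eq', Finset.mem_univ, if_true]

/-- `S₂(p′) = Σ_l D_l(p′)⁻² > 0` off the zero fibre (the main alias is positive). [cite: Balaban1984PropagatorsI, (1.31) p.23] -/
theorem aliasSum_pos (hn : 1 ≤ n) {q : Tor M} (hq : q ≠ 0) : 0 < ∑ k : Fin d → Fin n, 1 / DeltaXir n 0 (shiftr n k (sOf M q)) ^ 2 := by
  obtain ⟨μ0, hμ0⟩ : ∃ μ, sOf M q μ ≠ 0 := Function.ne_iff.mp (sOf_ne_zero M hq)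
  have hpos : 0 < DeltaXir n 0 (shiftr n (fun _ => (0 : Fin n)) (sOf M q)) := by
    rw [shiftr_zero]; exact DeltaXir_pos n hn (sOf M q) (abs_sOf_le M q) μ0 hμ0
  have hnn : ∀ k : Fin d → Fin n, 0 ≤ 1 / DeltaXir n 0 (shiftr n k (sOf M q)) ^ 2 := fun k => by
    have := DeltaXir_nonneg n 0 le_rfl (shiftr n k (sOf M q)); positivity
  exact lt_of_lt_of_le (by positivity) (Finset.single_le_sum (fun k _ => hnn k) (Finset.mem_univ (fun _ => (0 : Fin n))))

/-! ## §2 ★★★ Existence of the pinned biharmonic interpolant -/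

/-- ★★★ **THE PINNED BIHARMONIC INTERPOLANT EXISTS (flat, by Fourier)**: on `T_η = Tor (fine n M)` (`n ≥ 1`, η-units `Δ = LapS … n`), for every datum `m` on the centres there is `u`
with `u(up y) = m(y)` for all `y` and `Δ²u = 0` at every site that is not a centre — the row (E) of ✓ `…CentreHarmonicRegaugeSup.sup_regauge_le_of_rows` in the flat model.
[cite: Balaban1984PropagatorsI, (1.29)-(1.31) p.23, Sect. C p.22; Balaban1985RegularSpaces, (1.14) p.78] -/
theorem exists_pinned_biharmonic_interpolant (hn : 1 ≤ n) (m : Tor M → ℂ) :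
    ∃ u : Tor (fine n M) → ℂ, (∀ y, u (up n M y) = m y)
      ∧ ∀ x, (∀ y, x ≠ up n M y) → (LapS (fine n M) (n : ℂ) *ᵥ (LapS (fine n M) (n : ℂ) *ᵥ u)) x = 0 := by
  classical
  have hc : (n : ℂ) ≠ 0 := by exact_mod_cast NeZero.ne n
  -- letters
  set r : ℝ := cT (fine n M) / cT M with hr
  have hr0 : 0 < r := by rw [hr]; unfold cT; positivity
  set S : Tor M → ℝ := fun q => ∑ k : Fin d → Fin n, 1 / DeltaXir n 0 (shiftr n k (sOf M q)) ^ 2 with hS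
  set mhat : Tor M → ℂ := dft M *ᵥ m with hmhat
  -- the charges in momentum: `q̂(p′) = m̂(p′)/(r² S₂(p′))`, `q̂(0) = 0`
  set Qt : Tor M → ℂ := fun q => if q = 0 then 0 else mhat q / ((r : ℂ) * (r : ℂ) * (S q : ℂ)) with hQt
  set qv : Tor M → ℂ := (dft M)ᴴ *ᵥ Qt with hqv
  have hq_dft : dft M *ᵥ qv = Qt := by rw [hqv, dft_conjTranspose_mulVec]
  have hq0 : ∑ y, qv y = 0 := sum_eq_of_dft_zero M qv (by rw [hq_dft, hQt]; simp)
  set g : Tor (fine n M) → ℂ := fun x => ∑ y, if x = up n M y then qv y else 0 with hg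
  have hg0 : ∑ x, g x = 0 := by rw [hg, sum_comb, hq0]
  set u0 : Tor (fine n M) → ℂ := LapSinv (fine n M) (n : ℂ) *ᵥ (LapSinv (fine n M) (n : ℂ) *ᵥ g) with hu0
  set c0 : ℂ := (∑ y, (m y - u0 (up n M y))) / (Fintype.card (Tor M) : ℂ) with hc0
  refine ⟨fun x => u0 x + c0, ?_, ?_⟩
  · -- INTERPOLATION: compare the coarse DFTs of `y ↦ u0 (up y) + c0` and `m`
    have hcard : (Fintype.card (Tor M) : ℂ) ≠ 0 := by exact_mod_cast Fintype.card_ne_zero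
    have key : dft M *ᵥ (fun y => u0 (up n M y) + c0) = dft M *ᵥ m := by
      funext q
      have hsplit : (fun y => u0 (up n M y) + c0) = (fun y => u0 (up n M y)) + fun _ => c0 := rfl
      rw [hsplit, Matrix.mulVec_add, Pi.add_apply]
      by_cases hq : q = 0
      · -- the zero fibre: means
        subst hq
        have e1 : ∀ f : Tor M → ℂ, (dft M *ᵥ f) 0 = (cT M : ℂ) * ∑ y, f y := fun f => by
          simp only [Matrix.mulVec, dotProduct, dft_apply', chi_zero_left, map_one, mul_one, Finset.mul_sum]
        rw [e1, e1, e1, ← mul_add]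
        congr 1
        rw [Finset.sum_const, Finset.card_univ, nsmul_eq_mul, hc0, mul_div_cancel₀ _ hcard, Finset.sum_sub_distrib]
        ring
      · -- a fibre `p′ ≠ 0`: Poisson + flat alias weights
        rw [B5Phi162Torus.dft_const_of_ne M c0 hq, add_zero, dft_sample_up]
        have hD : ∀ k : Fin d → Fin n, lsym (fine n M) (n : ℂ) (pOf n M (k, q)) = ((DeltaXir n 0 (shiftr n k (sOf M q)) : ℝ) : ℂ) :=
          fun k => lsym_pOf n M k q
        have hterm : ∀ k : Fin d → Fin n, (dft (fine n M) *ᵥ u0) (pOf n M (k, q))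
            = (((DeltaXir n 0 (shiftr n k (sOf M q)) : ℝ) : ℂ))⁻¹ ^ 2 * (((cT (fine n M) / cT M : ℝ) : ℂ) * Qt q) := by
          intro k
          rw [hu0, dft_LapSinv_apply, dft_LapSinv_apply, hD, dft_comb_pOf, hq_dft, sq]
          ring
        simp_rw [hterm]
        rw [← Finset.sum_mul]
        have hSc : ∑ k : Fin d → Fin n, (((DeltaXir n 0 (shiftr n k (sOf M q)) : ℝ) : ℂ))⁻¹ ^ 2 = ((S q : ℝ) : ℂ) := by
          rw [hS]; push_cast
          refine Finset.sum_congr rfl fun k _ => ?_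
          rw [one_div, inv_pow]
        rw [hSc, hQt]
        simp only [if_neg hq]
        have hSpos : (S q : ℂ) ≠ 0 := by
          have := aliasSum_pos n M hn hq
          exact_mod_cast this.ne'
        have hrc : ((cT (fine n M) / cT M : ℝ) : ℂ) = (r : ℂ) := by rw [hr]
        have hr' : (r : ℂ) ≠ 0 := by exact_mod_cast hr0.ne'
        rw [hrc, hmhat]
        field_simp
    have := eq_of_dft_eq M _ _ key
    intro y
    exact congrFun this y
  · -- BIHARMONIC OFF THE CENTRES: `Δ²(Δ⁻²g + c0) = g`
    intro x hx
    have hconst : LapS (fine n M) (n : ℂ) *ᵥ (fun x => u0 x + c0) = LapS (fine n M) (n : ℂ) *ᵥ u0 := by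
      have hsplit : (fun x => u0 x + c0) = u0 + fun _ => c0 := rfl
      rw [hsplit, Matrix.mulVec_add, LapS_const, add_zero]
    have h1 : LapS (fine n M) (n : ℂ) *ᵥ u0 = LapSinv (fine n M) (n : ℂ) *ᵥ g := by
      rw [hu0, Matrix.mulVec_mulVec, Matrix.mulVec_mulVec, LapS_mul_LapSinv_mul_LapSinv]
    rw [hconst, h1, LapS_LapSinv_of_orth (fine n M) hc g hg0, hg]
    refine Finset.sum_eq_zero fun y _ => ?_
    rw [if_neg (hx y)]

end TwoTori

end Summit.QuantumFields.YangMills.Theorems.Prop7CentreHarmonicInterpolantFlat
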